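import Mathlib
import HarnessLib
import Summits.CriticalPhenomena.PercolationContinuityZ3.Theorems.PercNearOneGluingNoHeavyLowerTailKnQuestion8AntitheticLevels

/-!
# `NoHeavyLowerTail` (crux stmt-CriticalPhenomena-4575), antithetic vdBHK programme: the PRINCIPAL HUB CHARGE INEQUALITY WITH POTENTIAL

Support file (seat `prim-ineq-gen-7` gen 27; `--supports stmt-CriticalPhenomena-4575`).  Nothing is asserted about the crux; no `sorry`,
no definitions.  Memo: run/shared/lean/prim/prim-ineq-gen-7/FINDING-PHI-g27.md §1–§2 (THEOREM Φ⁺: the PRINCIPAL per-tree certificate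
inequality `(***)°` of the tree-block reduction — CONJECTURE Φ of FINDING-PATHS-g26 §6g — holds, with a nonnegative potential to spare, for
EVERY PATH rooted at an end vertex, and is inherited under root-edge subdivision).

CONTEXT.  `…KnQuestion8AntitheticHub.lean` (gen 26) proves the hub charge inequality for the `K`-extended certificates.  For the PRINCIPAL
certificates (`Φρ ∈ a` only) the analogous per-level inequality is false; the induction on the path length is rescued by a POTENTIAL
`Π₂(Y)` = the number of tops `τ` of the colouring poset all of whose red-supersets lie in `a ∩ b′`, all of whose successor's red-subsets
avoid `a′ ∪ b`, with `Φτ ∉ a ∩ b′` and `τ ∈ a′ ∪ b` (or the mirror pattern `a ↔ a′`, `b ↔ b′`): `val° − Π₂` is monotone under root-edge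
subdivision.  After Kleitman mixing in the `W`-direction (`AntitheticLevel.mixed_ge_pure`) the step is a sum over `y ⊆ W` of ONE local
inequality in twenty bits: for each of the up-sets `a, a′, b, b′` the membership of the hub bottom `B_y`, the hub top `T_y`, the
`F′`-bottom `β_y = Φ T_y` and the `F′`-top `τ_y` (`Φ τ_y = B_y`), subject to `B ⇒ T`, `B ⇒ τ`, `β ⇒ T`, `β ⇒ τ`, plus four closure bits
`Ap, Am, Np, Nm` ("every `F′`-top red-above `y` lies in `a ∩ b′`" / "in `a′ ∩ b`"; "every `F′`-bottom red-below `y` avoids `a′ ∪ b`" /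
"avoids `a ∪ b′`") subject to `Ap ⇒ τ ∈ a ∩ b′`, `B ∈ a ∩ b′ ⇒ Ap`, `Np ⇒ β ∉ a′ ∪ b`, `T ∉ a′ ∪ b ⇒ Np` and mirrors.  The inequality:
pure bilinear term + bottom certificate + principal top certificate + (new − old) certificate of the `F′`-top + [old potential at `y`]
− [new potential at `τ_y`] − [new potential at `T_y`] ≥ 0.

* four private lemmas `loc_…` — the closure bits `Ap, Am` fixed; quantifiers interleaved with the constraints so that `decide` only visits
  admissible branches (9,604 admissible configurations in all, minimum 0);
* `AntitheticPrincipalHub.principal_hub_local` — the local inequality with a flat signature;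
* `AntitheticPrincipalHub.principal_hub_charge` — the summed form on the Boolean lattice `2^W` with the MIXED bilinear term (involution
  `(y, bottom) ↔ (yᶜ, top)`): for upper families `S_B ⊆ S_T`, families `S_β ⊆ S_T ∩ S_τ`, `S_τ ⊇ S_B`, closure families `Ap ⊆ aτ ∩ b′τ`
  with `aB ∩ b′B ⊆ Ap`, `Am ⊆ a′τ ∩ bτ` with `a′B ∩ bB ⊆ Am`, `Np` disjoint from `a′β ∪ bβ` containing `(a′T ∪ bT)ᶜ`, `Nm` disjoint from
  `aβ ∪ b′β` containing `(aT ∪ b′T)ᶜ`:  `0 ≤ Σ_y [mixed bilinear] + Σ_y [c_B + c°_T + c_new − c°_old + old potential − new potential]`.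
  This is the kernel of the PRINCIPAL SUBDIVISION LEMMA `(val° − Π₂)(T) ≥ (val° − Π₂)(T/f) ∘ restriction` (root of degree 1, neck of
  degree 2), hence of THEOREM Φ⁺.
-/

namespace Summit.CriticalPhenomena.PercolationContinuityZ3.Theorems

open Finset

namespace AntitheticPrincipalHub

set_option synthInstance.maxSize 100000 in
/-- Case `(Ap, Am) = (false, false)` of `principal_hub_local`; quantifiers and constraints interleaved so that `decide` prunes early. -/
private theorem loc_ff :
    ∀ aT aτ aB : Bool, (aB = true → aT = true) → (aB = true → aτ = true) →
    ∀ aβ : Bool, (aβ = true → aT = true) → (aβ = true → aτ = true) →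
    ∀ a'T a'τ a'B : Bool, (a'B = true → a'T = true) → (a'B = true → a'τ = true) →
    ∀ a'β : Bool, (a'β = true → a'T = true) → (a'β = true → a'τ = true) →
    ∀ bT bτ bB : Bool, (bB = true → bT = true) → (bB = true → bτ = true) →
    ∀ bβ : Bool, (bβ = true → bT = true) → (bβ = true → bτ = true) →
    ∀ b'T b'τ b'B : Bool, (b'B = true → b'T = true) → (b'B = true → b'τ = true) →
    ∀ b'β : Bool, (b'β = true → b'T = true) → (b'β = true → b'τ = true) →
    (false = true → aτ = true) → (false = true → b'τ = true) → (aB = true → b'B = true → false = true) →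
    (false = true → a'τ = true) → (false = true → bτ = true) → (a'B = true → bB = true → false = true) →
    ∀ Np : Bool, (Np = true → a'β = false) → (Np = true → bβ = false) → (a'T = false → bT = false → Np = true) →
    ∀ Nm : Bool, (Nm = true → aβ = false) → (Nm = true → b'β = false) → (aT = false → b'T = false → Nm = true) →
    0 ≤ ((if aB then (1:ℤ) else 0) - (if a'T then (1:ℤ) else 0)) * ((if bB then (1:ℤ) else 0) - (if b'T then (1:ℤ) else 0)) + ((if aT then (1:ℤ) else 0) - (if a'B then (1:ℤ) else 0)) * ((if bT then (1:ℤ) else 0) - (if b'B then (1:ℤ) else 0))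
      + (if ((aT ∧ ¬ a'B ∧ ¬ bB ∧ b'T) ∨ (¬ aB ∧ a'T ∧ bT ∧ ¬ b'B)) then (1:ℤ) else 0)
      + (if ((aβ ∧ b'β ∧ ¬ a'T ∧ ¬ bT) ∨ (a'β ∧ bβ ∧ ¬ aT ∧ ¬ b'T)) then (1:ℤ) else 0)
      + (if ((aB ∧ b'B ∧ ¬ a'τ ∧ ¬ bτ) ∨ (a'B ∧ bB ∧ ¬ aτ ∧ ¬ b'τ)) then (1:ℤ) else 0)
      - (if ((aβ ∧ b'β ∧ ¬ a'τ ∧ ¬ bτ) ∨ (a'β ∧ bβ ∧ ¬ aτ ∧ ¬ b'τ)) then (1:ℤ) else 0)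
      + (if ((false ∧ Np ∧ ¬ (aβ ∧ b'β) ∧ (a'τ ∨ bτ)) ∨ (false ∧ Nm ∧ ¬ (a'β ∧ bβ) ∧ (aτ ∨ b'τ))) then (1:ℤ) else 0)
      - (if ((false ∧ aT ∧ b'T ∧ ¬ (a'B ∨ bB) ∧ ¬ (aB ∧ b'B) ∧ (a'τ ∨ bτ)) ∨ (false ∧ a'T ∧ bT ∧ ¬ (aB ∨ b'B) ∧ ¬ (a'B ∧ bB) ∧ (aτ ∨ b'τ))) then (1:ℤ) else 0)
      - (if ((aT ∧ b'T ∧ Np ∧ ¬ (a'B ∨ bB) ∧ ¬ (aβ ∧ b'β) ∧ (a'T ∨ bT)) ∨ (a'T ∧ bT ∧ Nm ∧ ¬ (aB ∨ b'B) ∧ ¬ (a'β ∧ bβ) ∧ (aT ∨ b'T))) then (1:ℤ) else 0) := by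
  decide

set_option synthInstance.maxSize 100000 in
/-- Case `(Ap, Am) = (false, true)` of `principal_hub_local`; quantifiers and constraints interleaved so that `decide` prunes early. -/
private theorem loc_ft :
    ∀ aT aτ aB : Bool, (aB = true → aT = true) → (aB = true → aτ = true) →
    ∀ aβ : Bool, (aβ = true → aT = true) → (aβ = true → aτ = true) →
    ∀ a'T a'τ a'B : Bool, (a'B = true → a'T = true) → (a'B = true → a'τ = true) →
    ∀ a'β : Bool, (a'β = true → a'T = true) → (a'β = true → a'τ = true) →
    ∀ bT bτ bB : Bool, (bB = true → bT = true) → (bB = true → bτ = true) →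
    ∀ bβ : Bool, (bβ = true → bT = true) → (bβ = true → bτ = true) →
    ∀ b'T b'τ b'B : Bool, (b'B = true → b'T = true) → (b'B = true → b'τ = true) →
    ∀ b'β : Bool, (b'β = true → b'T = true) → (b'β = true → b'τ = true) →
    (false = true → aτ = true) → (false = true → b'τ = true) → (aB = true → b'B = true → false = true) →
    (true = true → a'τ = true) → (true = true → bτ = true) → (a'B = true → bB = true → true = true) →
    ∀ Np : Bool, (Np = true → a'β = false) → (Np = true → bβ = false) → (a'T = false → bT = false → Np = true) →
    ∀ Nm : Bool, (Nm = true → aβ = false) → (Nm = true → b'β = false) → (aT = false → b'T = false → Nm = true) →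
    0 ≤ ((if aB then (1:ℤ) else 0) - (if a'T then (1:ℤ) else 0)) * ((if bB then (1:ℤ) else 0) - (if b'T then (1:ℤ) else 0)) + ((if aT then (1:ℤ) else 0) - (if a'B then (1:ℤ) else 0)) * ((if bT then (1:ℤ) else 0) - (if b'B then (1:ℤ) else 0))
      + (if ((aT ∧ ¬ a'B ∧ ¬ bB ∧ b'T) ∨ (¬ aB ∧ a'T ∧ bT ∧ ¬ b'B)) then (1:ℤ) else 0)
      + (if ((aβ ∧ b'β ∧ ¬ a'T ∧ ¬ bT) ∨ (a'β ∧ bβ ∧ ¬ aT ∧ ¬ b'T)) then (1:ℤ) else 0)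
      + (if ((aB ∧ b'B ∧ ¬ a'τ ∧ ¬ bτ) ∨ (a'B ∧ bB ∧ ¬ aτ ∧ ¬ b'τ)) then (1:ℤ) else 0)
      - (if ((aβ ∧ b'β ∧ ¬ a'τ ∧ ¬ bτ) ∨ (a'β ∧ bβ ∧ ¬ aτ ∧ ¬ b'τ)) then (1:ℤ) else 0)
      + (if ((false ∧ Np ∧ ¬ (aβ ∧ b'β) ∧ (a'τ ∨ bτ)) ∨ (true ∧ Nm ∧ ¬ (a'β ∧ bβ) ∧ (aτ ∨ b'τ))) then (1:ℤ) else 0)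
      - (if ((false ∧ aT ∧ b'T ∧ ¬ (a'B ∨ bB) ∧ ¬ (aB ∧ b'B) ∧ (a'τ ∨ bτ)) ∨ (true ∧ a'T ∧ bT ∧ ¬ (aB ∨ b'B) ∧ ¬ (a'B ∧ bB) ∧ (aτ ∨ b'τ))) then (1:ℤ) else 0)
      - (if ((aT ∧ b'T ∧ Np ∧ ¬ (a'B ∨ bB) ∧ ¬ (aβ ∧ b'β) ∧ (a'T ∨ bT)) ∨ (a'T ∧ bT ∧ Nm ∧ ¬ (aB ∨ b'B) ∧ ¬ (a'β ∧ bβ) ∧ (aT ∨ b'T))) then (1:ℤ) else 0) := by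
  decide

set_option synthInstance.maxSize 100000 in
/-- Case `(Ap, Am) = (true, false)` of `principal_hub_local`; quantifiers and constraints interleaved so that `decide` prunes early. -/
private theorem loc_tf :
    ∀ aT aτ aB : Bool, (aB = true → aT = true) → (aB = true → aτ = true) →
    ∀ aβ : Bool, (aβ = true → aT = true) → (aβ = true → aτ = true) →
    ∀ a'T a'τ a'B : Bool, (a'B = true → a'T = true) → (a'B = true → a'τ = true) →
    ∀ a'β : Bool, (a'β = true → a'T = true) → (a'β = true → a'τ = true) →
    ∀ bT bτ bB : Bool, (bB = true → bT = true) → (bB = true → bτ = true) →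
    ∀ bβ : Bool, (bβ = true → bT = true) → (bβ = true → bτ = true) →
    ∀ b'T b'τ b'B : Bool, (b'B = true → b'T = true) → (b'B = true → b'τ = true) →
    ∀ b'β : Bool, (b'β = true → b'T = true) → (b'β = true → b'τ = true) →
    (true = true → aτ = true) → (true = true → b'τ = true) → (aB = true → b'B = true → true = true) →
    (false = true → a'τ = true) → (false = true → bτ = true) → (a'B = true → bB = true → false = true) →
    ∀ Np : Bool, (Np = true → a'β = false) → (Np = true → bβ = false) → (a'T = false → bT = false → Np = true) →
    ∀ Nm : Bool, (Nm = true → aβ = false) → (Nm = true → b'β = false) → (aT = false → b'T = false → Nm = true) →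
    0 ≤ ((if aB then (1:ℤ) else 0) - (if a'T then (1:ℤ) else 0)) * ((if bB then (1:ℤ) else 0) - (if b'T then (1:ℤ) else 0)) + ((if aT then (1:ℤ) else 0) - (if a'B then (1:ℤ) else 0)) * ((if bT then (1:ℤ) else 0) - (if b'B then (1:ℤ) else 0))
      + (if ((aT ∧ ¬ a'B ∧ ¬ bB ∧ b'T) ∨ (¬ aB ∧ a'T ∧ bT ∧ ¬ b'B)) then (1:ℤ) else 0)
      + (if ((aβ ∧ b'β ∧ ¬ a'T ∧ ¬ bT) ∨ (a'β ∧ bβ ∧ ¬ aT ∧ ¬ b'T)) then (1:ℤ) else 0)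
      + (if ((aB ∧ b'B ∧ ¬ a'τ ∧ ¬ bτ) ∨ (a'B ∧ bB ∧ ¬ aτ ∧ ¬ b'τ)) then (1:ℤ) else 0)
      - (if ((aβ ∧ b'β ∧ ¬ a'τ ∧ ¬ bτ) ∨ (a'β ∧ bβ ∧ ¬ aτ ∧ ¬ b'τ)) then (1:ℤ) else 0)
      + (if ((true ∧ Np ∧ ¬ (aβ ∧ b'β) ∧ (a'τ ∨ bτ)) ∨ (false ∧ Nm ∧ ¬ (a'β ∧ bβ) ∧ (aτ ∨ b'τ))) then (1:ℤ) else 0)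
      - (if ((true ∧ aT ∧ b'T ∧ ¬ (a'B ∨ bB) ∧ ¬ (aB ∧ b'B) ∧ (a'τ ∨ bτ)) ∨ (false ∧ a'T ∧ bT ∧ ¬ (aB ∨ b'B) ∧ ¬ (a'B ∧ bB) ∧ (aτ ∨ b'τ))) then (1:ℤ) else 0)
      - (if ((aT ∧ b'T ∧ Np ∧ ¬ (a'B ∨ bB) ∧ ¬ (aβ ∧ b'β) ∧ (a'T ∨ bT)) ∨ (a'T ∧ bT ∧ Nm ∧ ¬ (aB ∨ b'B) ∧ ¬ (a'β ∧ bβ) ∧ (aT ∨ b'T))) then (1:ℤ) else 0) := by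
  decide

set_option synthInstance.maxSize 100000 in
/-- Case `(Ap, Am) = (true, true)` of `principal_hub_local`; quantifiers and constraints interleaved so that `decide` prunes early. -/
private theorem loc_tt :
    ∀ aT aτ aB : Bool, (aB = true → aT = true) → (aB = true → aτ = true) →
    ∀ aβ : Bool, (aβ = true → aT = true) → (aβ = true → aτ = true) →
    ∀ a'T a'τ a'B : Bool, (a'B = true → a'T = true) → (a'B = true → a'τ = true) →
    ∀ a'β : Bool, (a'β = true → a'T = true) → (a'β = true → a'τ = true) →
    ∀ bT bτ bB : Bool, (bB = true → bT = true) → (bB = true → bτ = true) →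
    ∀ bβ : Bool, (bβ = true → bT = true) → (bβ = true → bτ = true) →
    ∀ b'T b'τ b'B : Bool, (b'B = true → b'T = true) → (b'B = true → b'τ = true) →
    ∀ b'β : Bool, (b'β = true → b'T = true) → (b'β = true → b'τ = true) →
    (true = true → aτ = true) → (true = true → b'τ = true) → (aB = true → b'B = true → true = true) →
    (true = true → a'τ = true) → (true = true → bτ = true) → (a'B = true → bB = true → true = true) →
    ∀ Np : Bool, (Np = true → a'β = false) → (Np = true → bβ = false) → (a'T = false → bT = false → Np = true) →
    ∀ Nm : Bool, (Nm = true → aβ = false) → (Nm = true → b'β = false) → (aT = false → b'T = false → Nm = true) →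
    0 ≤ ((if aB then (1:ℤ) else 0) - (if a'T then (1:ℤ) else 0)) * ((if bB then (1:ℤ) else 0) - (if b'T then (1:ℤ) else 0)) + ((if aT then (1:ℤ) else 0) - (if a'B then (1:ℤ) else 0)) * ((if bT then (1:ℤ) else 0) - (if b'B then (1:ℤ) else 0))
      + (if ((aT ∧ ¬ a'B ∧ ¬ bB ∧ b'T) ∨ (¬ aB ∧ a'T ∧ bT ∧ ¬ b'B)) then (1:ℤ) else 0)
      + (if ((aβ ∧ b'β ∧ ¬ a'T ∧ ¬ bT) ∨ (a'β ∧ bβ ∧ ¬ aT ∧ ¬ b'T)) then (1:ℤ) else 0)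
      + (if ((aB ∧ b'B ∧ ¬ a'τ ∧ ¬ bτ) ∨ (a'B ∧ bB ∧ ¬ aτ ∧ ¬ b'τ)) then (1:ℤ) else 0)
      - (if ((aβ ∧ b'β ∧ ¬ a'τ ∧ ¬ bτ) ∨ (a'β ∧ bβ ∧ ¬ aτ ∧ ¬ b'τ)) then (1:ℤ) else 0)
      + (if ((true ∧ Np ∧ ¬ (aβ ∧ b'β) ∧ (a'τ ∨ bτ)) ∨ (true ∧ Nm ∧ ¬ (a'β ∧ bβ) ∧ (aτ ∨ b'τ))) then (1:ℤ) else 0)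
      - (if ((true ∧ aT ∧ b'T ∧ ¬ (a'B ∨ bB) ∧ ¬ (aB ∧ b'B) ∧ (a'τ ∨ bτ)) ∨ (true ∧ a'T ∧ bT ∧ ¬ (aB ∨ b'B) ∧ ¬ (a'B ∧ bB) ∧ (aτ ∨ b'τ))) then (1:ℤ) else 0)
      - (if ((aT ∧ b'T ∧ Np ∧ ¬ (a'B ∨ bB) ∧ ¬ (aβ ∧ b'β) ∧ (a'T ∨ bT)) ∨ (a'T ∧ bT ∧ Nm ∧ ¬ (aB ∨ b'B) ∧ ¬ (a'β ∧ bβ) ∧ (aT ∨ b'T))) then (1:ℤ) else 0) := by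
  decide

/-- **PRINCIPAL LOCAL HUB INEQUALITY WITH POTENTIAL** (memo §2).  Twenty bits — for each of the four up-sets `a, a′, b, b′` the
membership of the hub bottom `B`, the hub top `T`, the `F′`-bottom `β = Φ T` and the `F′`-top `τ` (`Φ τ = B`), constrained by `B ⇒ T`,
`B ⇒ τ`, `β ⇒ T`, `β ⇒ τ`, and four closure bits constrained by `Ap ⇒ aτ ∧ b′τ`, `aB ∧ b′B ⇒ Ap`, `Am ⇒ a′τ ∧ bτ`, `a′B ∧ bB ⇒ Am`,
`Np ⇒ ¬a′β ∧ ¬bβ`, `¬a′T ∧ ¬bT ⇒ Np`, `Nm ⇒ ¬aβ ∧ ¬b′β`, `¬aT ∧ ¬b′T ⇒ Nm` — satisfy: pure bilinear term + bottom certificate +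
principal top certificate + (new − old) `F′`-top certificate + old potential − new potential (two terms) ≥ 0.  (9,604 admissible
configurations, minimum 0.) [this work] -/
theorem principal_hub_local (aB aT aβ aτ a'B a'T a'β a'τ bB bT bβ bτ b'B b'T b'β b'τ Ap Am Np Nm : Bool)
    (h1 : aB = true → aT = true) (h2 : aB = true → aτ = true) (h3 : aβ = true → aT = true)
    (h4 : aβ = true → aτ = true) (h5 : a'B = true → a'T = true) (h6 : a'B = true → a'τ = true)
    (h7 : a'β = true → a'T = true) (h8 : a'β = true → a'τ = true) (h9 : bB = true → bT = true)
    (h10 : bB = true → bτ = true) (h11 : bβ = true → bT = true) (h12 : bβ = true → bτ = true)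
    (h13 : b'B = true → b'T = true) (h14 : b'B = true → b'τ = true) (h15 : b'β = true → b'T = true)
    (h16 : b'β = true → b'τ = true) (h17 : Ap = true → aτ = true) (h18 : Ap = true → b'τ = true)
    (h19 : aB = true → b'B = true → Ap = true) (h20 : Am = true → a'τ = true) (h21 : Am = true → bτ = true)
    (h22 : a'B = true → bB = true → Am = true) (h23 : Np = true → a'β = false) (h24 : Np = true → bβ = false)
    (h25 : a'T = false → bT = false → Np = true) (h26 : Nm = true → aβ = false) (h27 : Nm = true → b'β = false)
    (h28 : aT = false → b'T = false → Nm = true) :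
    0 ≤ ((if aB then (1:ℤ) else 0) - (if a'T then (1:ℤ) else 0)) * ((if bB then (1:ℤ) else 0) - (if b'T then (1:ℤ) else 0)) + ((if aT then (1:ℤ) else 0) - (if a'B then (1:ℤ) else 0)) * ((if bT then (1:ℤ) else 0) - (if b'B then (1:ℤ) else 0))
      + (if ((aT ∧ ¬ a'B ∧ ¬ bB ∧ b'T) ∨ (¬ aB ∧ a'T ∧ bT ∧ ¬ b'B)) then (1:ℤ) else 0)
      + (if ((aβ ∧ b'β ∧ ¬ a'T ∧ ¬ bT) ∨ (a'β ∧ bβ ∧ ¬ aT ∧ ¬ b'T)) then (1:ℤ) else 0)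
      + (if ((aB ∧ b'B ∧ ¬ a'τ ∧ ¬ bτ) ∨ (a'B ∧ bB ∧ ¬ aτ ∧ ¬ b'τ)) then (1:ℤ) else 0)
      - (if ((aβ ∧ b'β ∧ ¬ a'τ ∧ ¬ bτ) ∨ (a'β ∧ bβ ∧ ¬ aτ ∧ ¬ b'τ)) then (1:ℤ) else 0)
      + (if ((Ap ∧ Np ∧ ¬ (aβ ∧ b'β) ∧ (a'τ ∨ bτ)) ∨ (Am ∧ Nm ∧ ¬ (a'β ∧ bβ) ∧ (aτ ∨ b'τ))) then (1:ℤ) else 0)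
      - (if ((Ap ∧ aT ∧ b'T ∧ ¬ (a'B ∨ bB) ∧ ¬ (aB ∧ b'B) ∧ (a'τ ∨ bτ)) ∨ (Am ∧ a'T ∧ bT ∧ ¬ (aB ∨ b'B) ∧ ¬ (a'B ∧ bB) ∧ (aτ ∨ b'τ))) then (1:ℤ) else 0)
      - (if ((aT ∧ b'T ∧ Np ∧ ¬ (a'B ∨ bB) ∧ ¬ (aβ ∧ b'β) ∧ (a'T ∨ bT)) ∨ (a'T ∧ bT ∧ Nm ∧ ¬ (aB ∨ b'B) ∧ ¬ (a'β ∧ bβ) ∧ (aT ∨ b'T))) then (1:ℤ) else 0) := by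
  cases Ap <;> cases Am
  · exact loc_ff aT aτ aB h1 h2 aβ h3 h4 a'T a'τ a'B h5 h6 a'β h7 h8 bT bτ bB h9 h10 bβ h11 h12 b'T b'τ b'B h13 h14 b'β h15 h16 h17 h18 h19 h20 h21 h22 Np h23 h24 h25 Nm h26 h27 h28
  · exact loc_ft aT aτ aB h1 h2 aβ h3 h4 a'T a'τ a'B h5 h6 a'β h7 h8 bT bτ bB h9 h10 bβ h11 h12 b'T b'τ b'B h13 h14 b'β h15 h16 h17 h18 h19 h20 h21 h22 Np h23 h24 h25 Nm h26 h27 h28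
  · exact loc_tf aT aτ aB h1 h2 aβ h3 h4 a'T a'τ a'B h5 h6 a'β h7 h8 bT bτ bB h9 h10 bβ h11 h12 b'T b'τ b'B h13 h14 b'β h15 h16 h17 h18 h19 h20 h21 h22 Np h23 h24 h25 Nm h26 h27 h28
  · exact loc_tt aT aτ aB h1 h2 aβ h3 h4 a'T a'τ a'B h5 h6 a'β h7 h8 bT bτ bB h9 h10 bβ h11 h12 b'T b'τ b'B h13 h14 b'β h15 h16 h17 h18 h19 h20 h21 h22 Np h23 h24 h25 Nm h26 h27 h28

variable {α : Type*} [DecidableEq α] [Fintype α]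

/-- **PRINCIPAL HUB CHARGE INEQUALITY WITH POTENTIAL** (memo §2): Kleitman mixing in the `W`-direction for the two layers of the hub
(`AntitheticLevel.mixed_ge_pure` twice), then `principal_hub_local` at every `y ⊆ W`. [this work] -/
theorem principal_hub_charge (aB aT aβ aτ a'B a'T a'β a'τ bB bT bβ bτ b'B b'T b'β b'τ Ap Am Np Nm : Finset (Finset α))
    (haB : IsUpperSet (aB : Set (Finset α))) (haT : IsUpperSet (aT : Set (Finset α)))
    (ha'B : IsUpperSet (a'B : Set (Finset α))) (ha'T : IsUpperSet (a'T : Set (Finset α)))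
    (hbB : IsUpperSet (bB : Set (Finset α))) (hbT : IsUpperSet (bT : Set (Finset α)))
    (hb'B : IsUpperSet (b'B : Set (Finset α))) (hb'T : IsUpperSet (b'T : Set (Finset α)))
    (i1 : aB ⊆ aT) (i2 : aB ⊆ aτ) (i3 : aβ ⊆ aT) (i4 : aβ ⊆ aτ) (i5 : a'B ⊆ a'T) (i6 : a'B ⊆ a'τ) (i7 : a'β ⊆ a'T) (i8 : a'β ⊆ a'τ) (i9 : bB ⊆ bT) (i10 : bB ⊆ bτ) (i11 : bβ ⊆ bT) (i12 : bβ ⊆ bτ) (i13 : b'B ⊆ b'T) (i14 : b'B ⊆ b'τ) (i15 : b'β ⊆ b'T) (i16 : b'β ⊆ b'τ)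
    (n1 : Ap ⊆ aτ ∩ b'τ) (n2 : aB ∩ b'B ⊆ Ap) (n3 : Am ⊆ a'τ ∩ bτ) (n4 : a'B ∩ bB ⊆ Am)
    (n5 : Disjoint Np (a'β ∪ bβ)) (n6 : (a'T ∪ bT)ᶜ ⊆ Np) (n7 : Disjoint Nm (aβ ∪ b'β)) (n8 : (aT ∪ b'T)ᶜ ⊆ Nm) :
    0 ≤ (∑ y : Finset α, (((if y ∈ aB then (1:ℤ) else 0) - (if yᶜ ∈ a'T then (1:ℤ) else 0)) * ((if y ∈ bB then (1:ℤ) else 0) - (if yᶜ ∈ b'T then (1:ℤ) else 0)) + ((if y ∈ aT then (1:ℤ) else 0) - (if yᶜ ∈ a'B then (1:ℤ) else 0)) * ((if y ∈ bT then (1:ℤ) else 0) - (if yᶜ ∈ b'B then (1:ℤ) else 0))))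
        + ∑ y : Finset α,
          ((if ((y ∈ aT ∧ y ∉ a'B ∧ y ∉ bB ∧ y ∈ b'T) ∨ (y ∉ aB ∧ y ∈ a'T ∧ y ∈ bT ∧ y ∉ b'B)) then (1:ℤ) else 0)
          + (if ((y ∈ aβ ∧ y ∈ b'β ∧ y ∉ a'T ∧ y ∉ bT) ∨ (y ∈ a'β ∧ y ∈ bβ ∧ y ∉ aT ∧ y ∉ b'T)) then (1:ℤ) else 0)
          + (if ((y ∈ aB ∧ y ∈ b'B ∧ y ∉ a'τ ∧ y ∉ bτ) ∨ (y ∈ a'B ∧ y ∈ bB ∧ y ∉ aτ ∧ y ∉ b'τ)) then (1:ℤ) else 0)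
          - (if ((y ∈ aβ ∧ y ∈ b'β ∧ y ∉ a'τ ∧ y ∉ bτ) ∨ (y ∈ a'β ∧ y ∈ bβ ∧ y ∉ aτ ∧ y ∉ b'τ)) then (1:ℤ) else 0)
          + (if ((y ∈ Ap ∧ y ∈ Np ∧ ¬ (y ∈ aβ ∧ y ∈ b'β) ∧ (y ∈ a'τ ∨ y ∈ bτ)) ∨ (y ∈ Am ∧ y ∈ Nm ∧ ¬ (y ∈ a'β ∧ y ∈ bβ) ∧ (y ∈ aτ ∨ y ∈ b'τ))) then (1:ℤ) else 0)
          - (if ((y ∈ Ap ∧ y ∈ aT ∧ y ∈ b'T ∧ ¬ (y ∈ a'B ∨ y ∈ bB) ∧ ¬ (y ∈ aB ∧ y ∈ b'B) ∧ (y ∈ a'τ ∨ y ∈ bτ)) ∨ (y ∈ Am ∧ y ∈ a'T ∧ y ∈ bT ∧ ¬ (y ∈ aB ∨ y ∈ b'B) ∧ ¬ (y ∈ a'B ∧ y ∈ bB) ∧ (y ∈ aτ ∨ y ∈ b'τ))) then (1:ℤ) else 0)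
          - (if ((y ∈ aT ∧ y ∈ b'T ∧ y ∈ Np ∧ ¬ (y ∈ a'B ∨ y ∈ bB) ∧ ¬ (y ∈ aβ ∧ y ∈ b'β) ∧ (y ∈ a'T ∨ y ∈ bT)) ∨ (y ∈ a'T ∧ y ∈ bT ∧ y ∈ Nm ∧ ¬ (y ∈ aB ∨ y ∈ b'B) ∧ ¬ (y ∈ a'β ∧ y ∈ bβ) ∧ (y ∈ aT ∨ y ∈ b'T))) then (1:ℤ) else 0)) := by
  have mix1 := AntitheticLevel.mixed_ge_pure aB a'T bB b'T haB ha'T hbB hb'T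
  have mix2 := AntitheticLevel.mixed_ge_pure aT a'B bT b'B haT ha'B hbT hb'B
  have hloc : 0 ≤ ∑ y : Finset α, (((if y ∈ aB then (1:ℤ) else 0) - (if y ∈ a'T then (1:ℤ) else 0)) * ((if y ∈ bB then (1:ℤ) else 0) - (if y ∈ b'T then (1:ℤ) else 0)) + ((if y ∈ aT then (1:ℤ) else 0) - (if y ∈ a'B then (1:ℤ) else 0)) * ((if y ∈ bT then (1:ℤ) else 0) - (if y ∈ b'B then (1:ℤ) else 0))
          + (if ((y ∈ aT ∧ y ∉ a'B ∧ y ∉ bB ∧ y ∈ b'T) ∨ (y ∉ aB ∧ y ∈ a'T ∧ y ∈ bT ∧ y ∉ b'B)) then (1:ℤ) else 0)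
          + (if ((y ∈ aβ ∧ y ∈ b'β ∧ y ∉ a'T ∧ y ∉ bT) ∨ (y ∈ a'β ∧ y ∈ bβ ∧ y ∉ aT ∧ y ∉ b'T)) then (1:ℤ) else 0)
          + (if ((y ∈ aB ∧ y ∈ b'B ∧ y ∉ a'τ ∧ y ∉ bτ) ∨ (y ∈ a'B ∧ y ∈ bB ∧ y ∉ aτ ∧ y ∉ b'τ)) then (1:ℤ) else 0)
          - (if ((y ∈ aβ ∧ y ∈ b'β ∧ y ∉ a'τ ∧ y ∉ bτ) ∨ (y ∈ a'β ∧ y ∈ bβ ∧ y ∉ aτ ∧ y ∉ b'τ)) then (1:ℤ) else 0)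
          + (if ((y ∈ Ap ∧ y ∈ Np ∧ ¬ (y ∈ aβ ∧ y ∈ b'β) ∧ (y ∈ a'τ ∨ y ∈ bτ)) ∨ (y ∈ Am ∧ y ∈ Nm ∧ ¬ (y ∈ a'β ∧ y ∈ bβ) ∧ (y ∈ aτ ∨ y ∈ b'τ))) then (1:ℤ) else 0)
          - (if ((y ∈ Ap ∧ y ∈ aT ∧ y ∈ b'T ∧ ¬ (y ∈ a'B ∨ y ∈ bB) ∧ ¬ (y ∈ aB ∧ y ∈ b'B) ∧ (y ∈ a'τ ∨ y ∈ bτ)) ∨ (y ∈ Am ∧ y ∈ a'T ∧ y ∈ bT ∧ ¬ (y ∈ aB ∨ y ∈ b'B) ∧ ¬ (y ∈ a'B ∧ y ∈ bB) ∧ (y ∈ aτ ∨ y ∈ b'τ))) then (1:ℤ) else 0)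
          - (if ((y ∈ aT ∧ y ∈ b'T ∧ y ∈ Np ∧ ¬ (y ∈ a'B ∨ y ∈ bB) ∧ ¬ (y ∈ aβ ∧ y ∈ b'β) ∧ (y ∈ a'T ∨ y ∈ bT)) ∨ (y ∈ a'T ∧ y ∈ bT ∧ y ∈ Nm ∧ ¬ (y ∈ aB ∨ y ∈ b'B) ∧ ¬ (y ∈ a'β ∧ y ∈ bβ) ∧ (y ∈ aT ∨ y ∈ b'T))) then (1:ℤ) else 0)) := by
    refine Finset.sum_nonneg (fun y _ => ?_)
    have key := principal_hub_local (decide (y ∈ aB)) (decide (y ∈ aT)) (decide (y ∈ aβ)) (decide (y ∈ aτ)) (decide (y ∈ a'B)) (decide (y ∈ a'T)) (decide (y ∈ a'β)) (decide (y ∈ a'τ)) (decide (y ∈ bB)) (decide (y ∈ bT)) (decide (y ∈ bβ)) (decide (y ∈ bτ)) (decide (y ∈ b'B)) (decide (y ∈ b'T)) (decide (y ∈ b'β)) (decide (y ∈ b'τ))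
      (decide (y ∈ Ap)) (decide (y ∈ Am)) (decide (y ∈ Np)) (decide (y ∈ Nm))
      (by simpa using fun h => i1 h) (by simpa using fun h => i2 h) (by simpa using fun h => i3 h) (by simpa using fun h => i4 h) (by simpa using fun h => i5 h) (by simpa using fun h => i6 h) (by simpa using fun h => i7 h) (by simpa using fun h => i8 h) (by simpa using fun h => i9 h) (by simpa using fun h => i10 h) (by simpa using fun h => i11 h) (by simpa using fun h => i12 h) (by simpa using fun h => i13 h) (by simpa using fun h => i14 h) (by simpa using fun h => i15 h) (by simpa using fun h => i16 h)
      (by simpa using fun h => (Finset.mem_inter.mp (n1 h)).1) (by simpa using fun h => (Finset.mem_inter.mp (n1 h)).2)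
      (by simpa using fun h h' => n2 (Finset.mem_inter.mpr ⟨h, h'⟩))
      (by simpa using fun h => (Finset.mem_inter.mp (n3 h)).1) (by simpa using fun h => (Finset.mem_inter.mp (n3 h)).2)
      (by simpa using fun h h' => n4 (Finset.mem_inter.mpr ⟨h, h'⟩))
      (by simpa using fun h h' => (Finset.disjoint_left.mp n5 h) (Finset.mem_union.mpr (Or.inl h')))
      (by simpa using fun h h' => (Finset.disjoint_left.mp n5 h) (Finset.mem_union.mpr (Or.inr h')))
      (by simpa using fun h h' => n6 (Finset.mem_compl.mpr (by simp [Finset.mem_union, h, h'])))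
      (by simpa using fun h h' => (Finset.disjoint_left.mp n7 h) (Finset.mem_union.mpr (Or.inl h')))
      (by simpa using fun h h' => (Finset.disjoint_left.mp n7 h) (Finset.mem_union.mpr (Or.inr h')))
      (by simpa using fun h h' => n8 (Finset.mem_compl.mpr (by simp [Finset.mem_union, h, h'])))
    simpa only [decide_eq_true_eq, Bool.decide_and, Bool.decide_or, decide_not] using key
  have e1 : ∑ y : Finset α, (((if y ∈ aB then (1:ℤ) else 0) - (if y ∈ a'T then (1:ℤ) else 0)) * ((if y ∈ bB then (1:ℤ) else 0) - (if y ∈ b'T then (1:ℤ) else 0)) + ((if y ∈ aT then (1:ℤ) else 0) - (if y ∈ a'B then (1:ℤ) else 0)) * ((if y ∈ bT then (1:ℤ) else 0) - (if y ∈ b'B then (1:ℤ) else 0))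
          + (if ((y ∈ aT ∧ y ∉ a'B ∧ y ∉ bB ∧ y ∈ b'T) ∨ (y ∉ aB ∧ y ∈ a'T ∧ y ∈ bT ∧ y ∉ b'B)) then (1:ℤ) else 0)
          + (if ((y ∈ aβ ∧ y ∈ b'β ∧ y ∉ a'T ∧ y ∉ bT) ∨ (y ∈ a'β ∧ y ∈ bβ ∧ y ∉ aT ∧ y ∉ b'T)) then (1:ℤ) else 0)
          + (if ((y ∈ aB ∧ y ∈ b'B ∧ y ∉ a'τ ∧ y ∉ bτ) ∨ (y ∈ a'B ∧ y ∈ bB ∧ y ∉ aτ ∧ y ∉ b'τ)) then (1:ℤ) else 0)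
          - (if ((y ∈ aβ ∧ y ∈ b'β ∧ y ∉ a'τ ∧ y ∉ bτ) ∨ (y ∈ a'β ∧ y ∈ bβ ∧ y ∉ aτ ∧ y ∉ b'τ)) then (1:ℤ) else 0)
          + (if ((y ∈ Ap ∧ y ∈ Np ∧ ¬ (y ∈ aβ ∧ y ∈ b'β) ∧ (y ∈ a'τ ∨ y ∈ bτ)) ∨ (y ∈ Am ∧ y ∈ Nm ∧ ¬ (y ∈ a'β ∧ y ∈ bβ) ∧ (y ∈ aτ ∨ y ∈ b'τ))) then (1:ℤ) else 0)
          - (if ((y ∈ Ap ∧ y ∈ aT ∧ y ∈ b'T ∧ ¬ (y ∈ a'B ∨ y ∈ bB) ∧ ¬ (y ∈ aB ∧ y ∈ b'B) ∧ (y ∈ a'τ ∨ y ∈ bτ)) ∨ (y ∈ Am ∧ y ∈ a'T ∧ y ∈ bT ∧ ¬ (y ∈ aB ∨ y ∈ b'B) ∧ ¬ (y ∈ a'B ∧ y ∈ bB) ∧ (y ∈ aτ ∨ y ∈ b'τ))) then (1:ℤ) else 0)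
          - (if ((y ∈ aT ∧ y ∈ b'T ∧ y ∈ Np ∧ ¬ (y ∈ a'B ∨ y ∈ bB) ∧ ¬ (y ∈ aβ ∧ y ∈ b'β) ∧ (y ∈ a'T ∨ y ∈ bT)) ∨ (y ∈ a'T ∧ y ∈ bT ∧ y ∈ Nm ∧ ¬ (y ∈ aB ∨ y ∈ b'B) ∧ ¬ (y ∈ a'β ∧ y ∈ bβ) ∧ (y ∈ aT ∨ y ∈ b'T))) then (1:ℤ) else 0))
    = ∑ y : Finset α, (((if y ∈ aB then (1:ℤ) else 0) - (if y ∈ a'T then (1:ℤ) else 0)) * ((if y ∈ bB then (1:ℤ) else 0) - (if y ∈ b'T then (1:ℤ) else 0)))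
      + ∑ y : Finset α, (((if y ∈ aT then (1:ℤ) else 0) - (if y ∈ a'B then (1:ℤ) else 0)) * ((if y ∈ bT then (1:ℤ) else 0) - (if y ∈ b'B then (1:ℤ) else 0)))
      + ∑ y : Finset α, ((if ((y ∈ aT ∧ y ∉ a'B ∧ y ∉ bB ∧ y ∈ b'T) ∨ (y ∉ aB ∧ y ∈ a'T ∧ y ∈ bT ∧ y ∉ b'B)) then (1:ℤ) else 0)
          + (if ((y ∈ aβ ∧ y ∈ b'β ∧ y ∉ a'T ∧ y ∉ bT) ∨ (y ∈ a'β ∧ y ∈ bβ ∧ y ∉ aT ∧ y ∉ b'T)) then (1:ℤ) else 0)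
          + (if ((y ∈ aB ∧ y ∈ b'B ∧ y ∉ a'τ ∧ y ∉ bτ) ∨ (y ∈ a'B ∧ y ∈ bB ∧ y ∉ aτ ∧ y ∉ b'τ)) then (1:ℤ) else 0)
          - (if ((y ∈ aβ ∧ y ∈ b'β ∧ y ∉ a'τ ∧ y ∉ bτ) ∨ (y ∈ a'β ∧ y ∈ bβ ∧ y ∉ aτ ∧ y ∉ b'τ)) then (1:ℤ) else 0)
          + (if ((y ∈ Ap ∧ y ∈ Np ∧ ¬ (y ∈ aβ ∧ y ∈ b'β) ∧ (y ∈ a'τ ∨ y ∈ bτ)) ∨ (y ∈ Am ∧ y ∈ Nm ∧ ¬ (y ∈ a'β ∧ y ∈ bβ) ∧ (y ∈ aτ ∨ y ∈ b'τ))) then (1:ℤ) else 0)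
          - (if ((y ∈ Ap ∧ y ∈ aT ∧ y ∈ b'T ∧ ¬ (y ∈ a'B ∨ y ∈ bB) ∧ ¬ (y ∈ aB ∧ y ∈ b'B) ∧ (y ∈ a'τ ∨ y ∈ bτ)) ∨ (y ∈ Am ∧ y ∈ a'T ∧ y ∈ bT ∧ ¬ (y ∈ aB ∨ y ∈ b'B) ∧ ¬ (y ∈ a'B ∧ y ∈ bB) ∧ (y ∈ aτ ∨ y ∈ b'τ))) then (1:ℤ) else 0)
          - (if ((y ∈ aT ∧ y ∈ b'T ∧ y ∈ Np ∧ ¬ (y ∈ a'B ∨ y ∈ bB) ∧ ¬ (y ∈ aβ ∧ y ∈ b'β) ∧ (y ∈ a'T ∨ y ∈ bT)) ∨ (y ∈ a'T ∧ y ∈ bT ∧ y ∈ Nm ∧ ¬ (y ∈ aB ∨ y ∈ b'B) ∧ ¬ (y ∈ a'β ∧ y ∈ bβ) ∧ (y ∈ aT ∨ y ∈ b'T))) then (1:ℤ) else 0)) := by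
    rw [← Finset.sum_add_distrib, ← Finset.sum_add_distrib]
    exact Finset.sum_congr rfl (fun y _ => by ring)
  have e2 : ∑ y : Finset α, (((if y ∈ aB then (1:ℤ) else 0) - (if yᶜ ∈ a'T then (1:ℤ) else 0)) * ((if y ∈ bB then (1:ℤ) else 0) - (if yᶜ ∈ b'T then (1:ℤ) else 0)) + ((if y ∈ aT then (1:ℤ) else 0) - (if yᶜ ∈ a'B then (1:ℤ) else 0)) * ((if y ∈ bT then (1:ℤ) else 0) - (if yᶜ ∈ b'B then (1:ℤ) else 0)))
    = ∑ y : Finset α, (((if y ∈ aB then (1:ℤ) else 0) - (if yᶜ ∈ a'T then (1:ℤ) else 0)) * ((if y ∈ bB then (1:ℤ) else 0) - (if yᶜ ∈ b'T then (1:ℤ) else 0))) + ∑ y : Finset α, (((if y ∈ aT then (1:ℤ) else 0) - (if yᶜ ∈ a'B then (1:ℤ) else 0)) * ((if y ∈ bT then (1:ℤ) else 0) - (if yᶜ ∈ b'B then (1:ℤ) else 0))) := Finset.sum_add_distrib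
  rw [e1] at hloc
  rw [e2]
  linarith

end AntitheticPrincipalHub

end Summit.CriticalPhenomena.PercolationContinuityZ3.Theorems
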